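import Summits.CriticalPhenomena.PercolationContinuityZ3.Theorems.PercNearOneGluingNoHeavyLowerTailSunflowerGadgetModelBridge
import HarnessLib
import HarnessLib.Audit

/-!
# `NoHeavyLowerTail` (crux stmt-CriticalPhenomena-4575), abstract sunflower cubic: THE GADGET MODEL — part 3: the bridge theorem
# `GadgetModelLemma → TermWeightedIneq`, the A-safety of the handle family, and the odd cycles

Support file (seat `prim-ineq-prove-1` gen 71; `--supports stmt-CriticalPhenomena-4575`).  No `sorry`, no named facts.  Continues
`…SunflowerGadgetModel` / `…SunflowerGadgetModelBridge`.  Here: the graph-theoretic hypotheses `HandleGraph Γ A b c` (a triangle-free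
graph with a layered conditioning set `A` whose typeless vertices are exactly one edge `b c` — "bipartite graph on `A ⊔ T` plus a handle",
`HandleGraph.layered`), **`termWeightedIneq_of_gadgetModelLemma : HandleGraph Γ A b c → GadgetModelLemma → TermWeightedIneq Γ A`** (the
fibre of `resL A` is the `glue`-image of the free assignments; BAD ⟹ Bad with the same non-A set; Good ⟹ GOOD; the lemma in between),
**`safe_of_gadgetModelLemma`** (every graph of the handle family is A-safe under the lemma), `handleGraph_oddCond` (gen 70's conditioning of
`C_{2k+3}` is of this form), **`oddCycleTermWeighted_of_gadgetModelLemma`** and **`safe_cycleGraph_of_gadgetModelLemma`** (every cycle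
`C_N`, `N ≥ 5`).  Memo: run/shared/lean/prim/prim-ineq-prove-1/FINDING-LAYERED-prove1-g71.md §3.
-/

namespace Summit.CriticalPhenomena.PercolationContinuityZ3.Theorems.SunflowerPartition

namespace Bridge

open Finset MeasureTheory Literature.Probability.LatticeModels Literature.Probability.Percolation GadgetModel

variable {K n : ℕ}


/-! ### The graph hypotheses alone, and the main bridge theorem -/

section Main

variable (Γ : SimpleGraph (Fin n)) (A : Finset (Fin n)) (b c : Fin n)

/-- The graph-theoretic part of `HandleHyp`: a layered conditioning set `A` whose typeless vertices are exactly the edge `b c`, in a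
triangle-free graph (the "handle family"). -/
structure HandleGraph : Prop where
  indA : ∀ u ∈ A, ∀ v ∈ A, ¬ Γ.Adj u v
  hbA : b ∉ A
  hcA : c ∉ A
  hb : ∀ a ∈ A, ¬ Γ.Adj a b
  hc : ∀ a ∈ A, ¬ Γ.Adj a c
  hbc : Γ.Adj b c
  cover : ∀ v, v ∉ A → v ≠ b → v ≠ c → ∃ a ∈ A, Γ.Adj a v
  indT : ∀ u v, u ∉ A → v ∉ A → (∃ a ∈ A, Γ.Adj a u) → (∃ a ∈ A, Γ.Adj a v) → ¬ Γ.Adj u v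
  tf : Γ.CliqueFree 3

variable {Γ A b c}

/-- A graph of the handle family has `A` layered. [this work] -/
theorem HandleGraph.layered (HG : HandleGraph Γ A b c) : Layered Γ A := ⟨HG.indA, HG.indT⟩

open scoped Classical in
/-- **THE BRIDGE.**  `GadgetModelLemma` implies the termwise weighted inequality for every graph of the handle family and its layered
conditioning set `A`: on the fibre of `resL A` over a key, the configurations are the `glue`-images of the free assignments
(`fibre_eq_image`), the global BAD ones are Bad in `gadgetModelOf` with the same non-A set, and the model's Good ones are globally GOOD.
[this work] -/
theorem termWeightedIneq_of_gadgetModelLemma (HG : HandleGraph Γ A b c) (hGM : GadgetModelLemma) : TermWeightedIneq Γ A := by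
  classical
  intro K V hV hcap m S₀
  have H : HandleHyp Γ A b c V :=
    ⟨HG.indA, HG.hbA, HG.hcA, HG.hb, HG.hc, HG.hbc, HG.cover, HG.indT, HG.tf, hV, hcap⟩
  set C := TypeModel.Model.confs (ι := Fin n) (K := K) m with hC
  by_cases hne : ((C.filter fun S => resL A S = resL A S₀)).Nonempty
  swap
  · rw [Finset.not_nonempty_iff_eq_empty] at hne
    rw [hne]; simp
  obtain ⟨S₁, hS₁⟩ := hne
  rw [Finset.mem_filter] at hS₁
  have hfib : (C.filter fun S => resL A S = resL A S₀) = (C.filter fun S => resL A S = resL A S₁) := by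
    rw [hS₁.2]
  rw [hfib, Finset.sum_filter, fibre_eq_image A m hS₁.1]
  set SL := resL A S₁
  set M := gadgetModelOf Γ A b c V SL H with hM
  have step2 := hGM K (Rv A) (Fin K) M (fun x : Rv A => m x.1)
  set CR := TypeModel.Model.confs (K := K) (fun x : Rv A => m x.1) with hCR
  have hinj := glue_injective A SL
  rw [Finset.sum_image (fun T _ T' _ h => hinj h)]
  rw [Finset.filter_image, Finset.card_image_of_injective _ hinj]
  have step1 : ∑ T ∈ CR, (if BadG (SafeCalc.edgeCore Γ) (Wof Γ V) (glue A SL T) then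
        (K - (J (SafeCalc.edgeCore Γ) (glue A SL T)).card).factorial else 0) ≤
      ∑ T ∈ CR.filter (fun T => M.Bad T), (K - (M.nonA T).card).factorial := by
    rw [Finset.sum_filter]
    refine Finset.sum_le_sum fun T _ => ?_
    by_cases hb : BadG (SafeCalc.edgeCore Γ) (Wof Γ V) (glue A SL T)
    · have hB : M.Bad T := bad_of_badG' H hb
      rw [if_pos hb, if_pos hB, nonA_gadgetModelOf_eq_J H T]
    · rw [if_neg hb]; exact Nat.zero_le _
  have step3 : (CR.filter fun T => M.Good T).card ≤
      (CR.filter fun T => GoodG (SafeCalc.edgeCore Γ) (Wof Γ V) (glue A SL T)).card :=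
    Finset.card_le_card (Finset.monotone_filter_right _ fun T _ hg => goodG_of_good' H hg)
  calc ∑ T ∈ CR, (if BadG (SafeCalc.edgeCore Γ) (Wof Γ V) (glue A SL T) then
          (K - (J (SafeCalc.edgeCore Γ) (glue A SL T)).card).factorial else 0)
      ≤ ∑ T ∈ CR.filter (fun T => M.Bad T), (K - (M.nonA T).card).factorial := step1
    _ ≤ (K - 1).factorial * (CR.filter fun T => M.Good T).card := by
        convert step2 using 2
        · ext S; simp only [Finset.mem_filter, hCR, TypeModel.Model.mem_confs]
        · congr 1; ext S; simp only [Finset.mem_filter, hCR, TypeModel.Model.mem_confs]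
    _ ≤ (K - 1).factorial * (CR.filter fun T => GoodG (SafeCalc.edgeCore Γ) (Wof Γ V) (glue A SL T)).card :=
        Nat.mul_le_mul_left _ step3

/-- **Every graph of the handle family has an A-safe core, under `GadgetModelLemma`** (bipartite graph on `A ⊔ T` plus the edge `b c`
with the other neighbours of `b`, `c` in `T`): all odd cycles, theta graphs, "bipartite + odd handle", … [this work] -/
theorem safe_of_gadgetModelLemma (HG : HandleGraph Γ A b c) (hGM : GadgetModelLemma) (p : Fin n → unitInterval) :
    SafeCalc.Safe p (SafeCalc.edgeCore Γ) :=
  safe_edgeCore_of_weightedIneq Γ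
    (weightedIneq_of_termWeightedIneq Γ A (termWeightedIneq_of_gadgetModelLemma HG hGM)) p

end Main

/-! ### The odd cycles -/

/-- The odd cycle `C_{2k+3}` (`k ≥ 1`) with gen 70's conditioning set `{3, 5, …, 2k+1}` is a graph of the handle family with
`b = 0`, `c = 1` (stated for the vertices with labels `0` and `1`). [this work] -/
theorem handleGraph_oddCond (k : ℕ) (hk : 1 ≤ k) (b c : Fin (2 * k + 3)) (hb0 : b.val = 0) (hc1 : c.val = 1) :
    HandleGraph (SimpleGraph.cycleGraph (2 * k + 3)) (oddCond k) b c := by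
  have hN : 3 ≤ 2 * k + 3 := by omega
  have hL := layered_oddCond k
  refine ⟨hL.1, ?_, ?_, ?_, ?_, ?_, ?_, hL.2, cycleGraph_cliqueFree_three (by omega)⟩
  · simp only [oddCond, Finset.mem_filter, Finset.mem_univ, true_and, not_and, not_le]; omega
  · simp only [oddCond, Finset.mem_filter, Finset.mem_univ, true_and, not_and, not_le]; omega
  · intro a ha h
    simp only [oddCond, Finset.mem_filter, Finset.mem_univ, true_and] at ha
    rw [cycleGraph_adj_iff_val_succ hN] at h
    have := a.isLt
    omega
  · intro a ha h
    simp only [oddCond, Finset.mem_filter, Finset.mem_univ, true_and] at ha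
    rw [cycleGraph_adj_iff_val_succ hN] at h
    have := a.isLt
    omega
  · rw [cycleGraph_adj_iff_val_succ hN]
    omega
  · intro v hv hvb hvc
    simp only [oddCond, Finset.mem_filter, Finset.mem_univ, true_and, not_and, not_le] at hv
    have hv' := v.isLt
    have h0 : v.val ≠ 0 := fun h => hvb (Fin.ext (by omega))
    have h1 : v.val ≠ 1 := fun h => hvc (Fin.ext (by omega))
    by_cases hle : v.val + 1 < 2 * k + 3
    · refine ⟨⟨v.val + 1, hle⟩, ?_, ?_⟩
      · simp only [oddCond, Finset.mem_filter, Finset.mem_univ, true_and]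
        constructor
        · show (v.val + 1) % 2 = 1
          omega
        · show 3 ≤ v.val + 1
          omega
      · rw [cycleGraph_adj_iff_val_succ hN]
        exact Or.inr (Or.inl rfl)
    · refine ⟨⟨v.val - 1, by omega⟩, ?_, ?_⟩
      · simp only [oddCond, Finset.mem_filter, Finset.mem_univ, true_and]
        constructor
        · show (v.val - 1) % 2 = 1
          omega
        · show 3 ≤ v.val - 1
          omega
      · rw [cycleGraph_adj_iff_val_succ hN]
        refine Or.inl ?_
        show v.val - 1 + 1 = v.val
        omega

/-- **`GadgetModelLemma` implies gen 70's typed target `OddCycleTermWeighted`.** [this work] -/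
theorem oddCycleTermWeighted_of_gadgetModelLemma (hGM : GadgetModelLemma) : OddCycleTermWeighted :=
  fun k hk => termWeightedIneq_of_gadgetModelLemma (handleGraph_oddCond k hk ⟨0, by omega⟩ ⟨1, by omega⟩ rfl rfl) hGM

/-- **Under `GadgetModelLemma` every cycle `C_N`, `N ≥ 5`, has an A-safe core** (g70's `safe_edgeCore_cycleGraph_of_termWeighted`).
[this work] -/
theorem safe_cycleGraph_of_gadgetModelLemma (hGM : GadgetModelLemma) (N : ℕ) (hN : 5 ≤ N) (p : Fin N → unitInterval) :
    SafeCalc.Safe p (SafeCalc.edgeCore (SimpleGraph.cycleGraph N)) :=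
  safe_edgeCore_cycleGraph_of_termWeighted (oddCycleTermWeighted_of_gadgetModelLemma hGM) N hN p

end Bridge

end Summit.CriticalPhenomena.PercolationContinuityZ3.Theorems.SunflowerPartition
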